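import Mathlib
import HarnessLib
import Summits.Ventures.LatticeQCDFlow.Scaling.TorusCellularHomologyOne
import Summits.Ventures.LatticeQCDFlow.Scaling.TorusSignedBoundary

/-!
# LatticeQCDFlow / Scaling — the integer span of a full ranked structure of `(ℤ/L)^d`:
# every divergence-free, winding-free INTEGER 1-chain — in particular every signed plaquette
# boundary — is an integer combination of the signed boundaries of the covered plaquettes

HONEST FRAMING: exact (Metropolis-corrected) sampling algorithms for lattice gauge theory;
figures of merit are autocorrelation/cost numbers at stated couplings and volumes; no
continuum-physics claim.

Venture `LatticeQCDFlow` (cell pub-lqcd), topic `Scaling`, FANOUT row 30 (lean-1, GEN-27) — OUR WORK on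
THEORY-2.md §4 row C5 (gen25 Q2, the ℤ-COEFFICIENT DETERMINATION, part 2 of 2).  A collection `B` of
plaquettes of `(ℤ/L)^d` RANKED for a top-link assignment `t` (`t p` a link of `p`; `rank p < rank p'`
whenever `t p` lies on another `p' ∈ B`) carries an exact one-plaquette heat-bath autoregression
(`Scaling/AutoregressiveGaugeHeatBathRanked`); at most `(d−1)(L^d − 1)` plaquettes can be ranked
(`TorusRankedHomologyBound`, `TorusRankedMorseCount`), and `TorusCellularHomologyOne` showed over `ℤ/2` that
the boundaries of such a FULL ranked structure span every plaquette boundary.  Here the statement is lifted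
to INTEGER coefficients with the signed boundaries `σ∂p`, divergence and winding of
`Scaling/TorusSignedBoundary` — which is what the holonomies of an abelian gauge field see (sequel
`Scaling/AbelianHolonomyDetermination`: every plaquette holonomy is a Laurent monomial in the covered ones):

* §3 over `ℤ/2`: **`mem_span_boundaryVec_of_parity_winding`** — a chain with zero vertex parity and zero
  winding lies in the span of all plaquette boundaries (the span is INSIDE the kernel of `(∂₁, winding)` and
  both have dimension `(d−1)(L^d − 1)`, `TorusCellularHomologyOne`), hence in the span of the boundaries of
  any full ranked `B`;
* §4 DESCENT: **`eq_zero_of_divergence_winding_top`** — an integer chain with zero divergence and zero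
  winding that vanishes at every top link of a full ranked `B` is `0` (mod `2` it is a combination of the
  boundaries of `B` vanishing at the top links, so it is even; halve and induct on `Σ_e |v_e|`);
* §5 ELIMINATION: **`exists_coeff_sub_sum_apply_top_eq_zero`** — for every integer chain `v` and every
  ranked `B` there are integers `c_p` with `v − Σ_{p∈B} c_p σ∂p` vanishing at every top link (peel the
  maximal rank: unitriangular with `±1` pivots);
* §6 **`exists_eq_sum_smul_signedBoundary`** — THE INTEGER SPAN: for a full ranked `B`
  (`#B = (d−1)(L^d − 1)`; every optimal structure is full, `TorusSignedBoundary` §3) every integer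
  chain with zero divergence and zero winding is `Σ_{p∈B} c_p σ∂p` with UNIQUE integers `c_p`
  (**`sum_smul_signedBoundary_unique`**); in particular **`exists_signedBoundary_eq_sum`** — every plaquette
  boundary, covered or not.  (So `{σ∂p : p ∈ B}` is a `ℤ`-basis of the integer boundary group
  `B₁((ℤ/L)^d; ℤ) = ker(div) ∩ ker(winding)`, peelable along the rank.)

No `def` (chains, boundaries and functionals are spelled out as terms), no `sorry`, nothing cited as a fact
beyond the tree.
-/

namespace Summit.Ventures.LatticeQCDFlow.Theory2.Autoregressive

open Finset
open Literature.MathematicalPhysics.QuantumFieldTheory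

variable {d L : ℕ} [NeZero L]

/-! ## §3 Over `ℤ/2`: cycles with zero winding are combinations of boundaries -/

/-- **Over `ℤ/2`, a chain with zero vertex parity and zero winding lies in the span of the plaquette
boundaries** (`L ≥ 2`): the span lies inside the kernel of `(∂₁, winding)`, and both have dimension
`(d−1)(L^d − 1)` (`TorusCellularHomologyOne.finrank_span_boundaryVec`, `le_finrank_range_parityWinding`).
[ours] -/
theorem mem_span_boundaryVec_of_parity_winding (hL : 2 ≤ L) (f : Edge d L → ZMod 2)
    (hpar : (fun y : Site d L => ∑ i : Fin d, (f (y, i) + f (y - Pi.single i 1, i))) = 0)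
    (hwind : (fun m : Fin d => ∑ x ∈ (Finset.univ.filter fun x : Site d L => x m = 0), f (x, m)) = 0) :
    f ∈ Submodule.span (ZMod 2) (Set.range fun p : Plaquette d L =>
      (Pi.single (p.1, p.2.1.1) 1 + Pi.single (p.1.shift p.2.1.1, p.2.1.2) 1 +
        Pi.single (p.1.shift p.2.1.2, p.2.1.1) 1 + Pi.single (p.1, p.2.1.2) 1 : Edge d L → ZMod 2)) := by
  classical
  set S := Submodule.span (ZMod 2) (Set.range fun p : Plaquette d L =>
      (Pi.single (p.1, p.2.1.1) 1 + Pi.single (p.1.shift p.2.1.1, p.2.1.2) 1 +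
        Pi.single (p.1.shift p.2.1.2, p.2.1.1) 1 + Pi.single (p.1, p.2.1.2) 1 : Edge d L → ZMod 2)) with hS
  set ψ := ((vertexParity_isLinear (d := d) (L := L)).mk').prod ((winding_isLinear (d := d) (L := L)).mk')
    with hψ
  have hψapply : ∀ g, ψ g = (((vertexParity_isLinear (d := d) (L := L)).mk') g,
      ((winding_isLinear (d := d) (L := L)).mk') g) := fun g => rfl
  have hsub : S ≤ LinearMap.ker ψ := by
    rw [hS, Submodule.span_le]
    rintro _ ⟨p, rfl⟩
    rw [SetLike.mem_coe, LinearMap.mem_ker, hψapply, Prod.mk_eq_zero, IsLinearMap.mk'_apply,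
      IsLinearMap.mk'_apply]
    exact ⟨vertexParity_boundaryVec p, funext fun m => winding_boundaryVec p m⟩
  have hfK : f ∈ LinearMap.ker ψ := by
    rw [LinearMap.mem_ker, hψapply, Prod.mk_eq_zero, IsLinearMap.mk'_apply, IsLinearMap.mk'_apply]
    exact ⟨hpar, hwind⟩
  have hSdim : Module.finrank (ZMod 2) S = (d - 1) * (L ^ d - 1) := by
    rw [hS]; exact finrank_span_boundaryVec hL
  have h2 : Fintype.card (Site d L) - 1 + d ≤ Module.finrank (ZMod 2) (LinearMap.range ψ) :=
    le_finrank_range_parityWinding (d := d) (L := L)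
  have h3 := LinearMap.finrank_range_add_finrank_ker ψ
  have h4 : Module.finrank (ZMod 2) (Edge d L → ZMod 2) = Fintype.card (Edge d L) :=
    Module.finrank_fintype_fun_eq_card _
  rw [Summit.Ventures.LatticeQCDFlow.Runbook.card_site] at h2
  rw [Summit.Ventures.LatticeQCDFlow.Runbook.card_edge] at h4
  have hKle : Module.finrank (ZMod 2) (LinearMap.ker ψ) ≤ Module.finrank (ZMod 2) S := by
    rw [hSdim]
    have hX : 1 ≤ L ^ d := Nat.one_le_pow _ _ (by omega)
    rcases Nat.eq_zero_or_pos d with hd | hd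
    · subst hd
      simp only [pow_zero, mul_zero] at h4
      simp only [Nat.zero_sub, zero_mul, nonpos_iff_eq_zero]
      omega
    · obtain ⟨Y, hY⟩ : ∃ Y, L ^ d = Y + 1 := ⟨L ^ d - 1, by omega⟩
      rw [hY] at h2 h4 ⊢
      obtain ⟨e, rfl⟩ : ∃ e, d = e + 1 := ⟨d - 1, by omega⟩
      simp only [Nat.add_sub_cancel] at h2 ⊢
      have h5 : (Y + 1) * (e + 1) = e * Y + Y + e + 1 := by ring
      rw [h5] at h4
      nlinarith [h2, h3, h4]
  have hEq : S = LinearMap.ker ψ := Submodule.eq_of_le_of_finrank_le hsub hKle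
  rw [hEq]
  exact hfK

omit [NeZero L] in
/-- Unpacking membership in the span of the boundaries of `B` as an explicit combination
`Σ_{p∈B} g_p σ∂p` of SIGNED boundaries over `ℤ/2` (where signed = unsigned). [ours] -/
theorem exists_sum_smul_signedBoundary_of_mem_span (B : Finset (Plaquette d L)) (f : Edge d L → ZMod 2)
    (hf : f ∈ Submodule.span (ZMod 2) (Set.range fun p : B =>
      (Pi.single ((p : Plaquette d L).1, (p : Plaquette d L).2.1.1) 1 +
        Pi.single ((p : Plaquette d L).1.shift (p : Plaquette d L).2.1.1, (p : Plaquette d L).2.1.2) 1 +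
        Pi.single ((p : Plaquette d L).1.shift (p : Plaquette d L).2.1.2, (p : Plaquette d L).2.1.1) 1 +
        Pi.single ((p : Plaquette d L).1, (p : Plaquette d L).2.1.2) 1 : Edge d L → ZMod 2))) :
    ∃ g : Plaquette d L → ZMod 2, (∑ p' ∈ B, g p' • (Pi.single (p'.1, p'.2.1.1) 1 + Pi.single (p'.1.shift p'.2.1.1, p'.2.1.2) 1 -
        Pi.single (p'.1.shift p'.2.1.2, p'.2.1.1) 1 - Pi.single (p'.1, p'.2.1.2) 1 : Edge d L → ZMod 2)) = f := by
  classical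
  obtain ⟨c, hc⟩ := (Submodule.mem_span_range_iff_exists_fun (ZMod 2)).1 hf
  refine ⟨fun p => if h : p ∈ B then c ⟨p, h⟩ else 0, ?_⟩
  rw [← hc, ← Finset.sum_coe_sort B]
  refine Finset.sum_congr rfl fun p _ => ?_
  dsimp only
  rw [dif_pos p.2, signedBoundary_zmod_two_eq]

/-! ## §4 Descent: an even start, then halve -/

/-- **DESCENT.**  `L ≥ 2`; `(B, t, rank)` ranked and FULL (`#B = (d−1)(L^d − 1)`).  An integer chain `v` with
zero divergence, zero winding and `v(t p) = 0` for every `p ∈ B` is `0`: mod `2` it is a combination of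
the boundaries of `B` (§3 and `TorusCellularHomologyOne.span_boundaryVec_eq_of_ranked_card`) vanishing at
the top links, hence even (§1); its half has the same three properties and a smaller `Σ_e |v_e|`. [ours] -/
theorem eq_zero_of_divergence_winding_top (hL : 2 ≤ L) (B : Finset (Plaquette d L))
    (t : Plaquette d L → Edge d L)
    (ht : ∀ p ∈ B, t p ∈ ({(p.1, p.2.1.1), (p.1.shift p.2.1.1, p.2.1.2),
        (p.1.shift p.2.1.2, p.2.1.1), (p.1, p.2.1.2)} : Finset (Edge d L)))
    (rank : Plaquette d L → ℕ)
    (hrank : ∀ p ∈ B, ∀ p' ∈ B, p ≠ p' → t p ∈ ({(p'.1, p'.2.1.1), (p'.1.shift p'.2.1.1, p'.2.1.2),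
        (p'.1.shift p'.2.1.2, p'.2.1.1), (p'.1, p'.2.1.2)} : Finset (Edge d L)) → rank p < rank p')
    (hcard : B.card = (d - 1) * (L ^ d - 1)) (v : Edge d L → ℤ)
    (hdiv : (fun y : Site d L => ∑ i : Fin d, (v (y, i) - v (y - Pi.single i 1, i))) = 0)
    (hwind : (fun m : Fin d => ∑ x ∈ (Finset.univ.filter fun x : Site d L => x m = 0), v (x, m)) = 0)
    (htop : ∀ p ∈ B, v (t p) = 0) : v = 0 := by
  classical
  suffices key : ∀ (N : ℕ) (v : Edge d L → ℤ), ∑ e, (v e).natAbs = N →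
      (fun y : Site d L => ∑ i : Fin d, (v (y, i) - v (y - Pi.single i 1, i))) = 0 →
      (fun m : Fin d => ∑ x ∈ (Finset.univ.filter fun x : Site d L => x m = 0), v (x, m)) = 0 →
      (∀ p ∈ B, v (t p) = 0) → v = 0 from key _ v rfl hdiv hwind htop
  intro N
  induction N using Nat.strong_induction_on with
  | _ N ih =>
  intro v hN hdiv hwind htop
  by_contra hv
  -- Step 1: mod 2, `v` is a combination of the boundaries of `B` vanishing at the top links, hence `0`
  have hpar' : (fun y : Site d L => ∑ i : Fin d,
      ((((v (y, i) : ℤ) : ZMod 2)) + (((v (y - Pi.single i 1, i) : ℤ) : ZMod 2)))) = 0 := by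
    funext y
    have h := congrFun hdiv y
    simp only [Pi.zero_apply] at h ⊢
    rw [← intCast_intDivergence, h, Int.cast_zero]
  have hwind' : (fun m : Fin d => ∑ x ∈ (Finset.univ.filter fun x : Site d L => x m = 0),
      (((v (x, m) : ℤ) : ZMod 2))) = 0 := by
    funext m
    have h := congrFun hwind m
    simp only [Pi.zero_apply] at h ⊢
    rw [← intCast_intWinding, h, Int.cast_zero]
  have hmem := mem_span_boundaryVec_of_parity_winding hL (fun e => ((v e : ℤ) : ZMod 2)) hpar' hwind'
  rw [← span_boundaryVec_eq_of_ranked_card hL B t ht rank hrank hcard] at hmem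
  obtain ⟨g, hg⟩ := exists_sum_smul_signedBoundary_of_mem_span B _ hmem
  have hg0 : ∀ p ∈ B, g p = 0 := by
    refine eq_zero_of_sum_smul_signedBoundary_apply_top hL B t ht rank hrank g ?_
    intro p hp
    rw [hg]
    simp only [htop p hp, Int.cast_zero]
  have hbar : ∀ e, ((v e : ℤ) : ZMod 2) = 0 := by
    intro e
    have h := congrFun hg e
    rw [Finset.sum_apply, Finset.sum_eq_zero (fun p hp => by rw [Pi.smul_apply, hg0 p hp, zero_smul])] at h
    exact h.symm
  -- Step 2: halve
  have heven : ∀ e, (2 : ℤ) ∣ v e := fun e => (ZMod.intCast_zmod_eq_zero_iff_dvd (v e) 2).1 (hbar e)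
  set g₂ : Edge d L → ℤ := fun e => v e / 2 with hg₂
  have hvg : ∀ e, v e = 2 * g₂ e := fun e => (Int.mul_ediv_cancel' (heven e)).symm
  have hdiv₂ : (fun y : Site d L => ∑ i : Fin d, (g₂ (y, i) - g₂ (y - Pi.single i 1, i))) = 0 := by
    funext y
    have h := congrFun hdiv y
    simp only [Pi.zero_apply, hvg, ← mul_sub, ← Finset.mul_sum] at h ⊢
    exact (mul_eq_zero.1 h).resolve_left two_ne_zero
  have hwind₂ : (fun m : Fin d => ∑ x ∈ (Finset.univ.filter fun x : Site d L => x m = 0), g₂ (x, m)) = 0 := by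
    funext m
    have h := congrFun hwind m
    simp only [Pi.zero_apply, hvg, ← Finset.mul_sum] at h ⊢
    exact (mul_eq_zero.1 h).resolve_left two_ne_zero
  have htop₂ : ∀ p ∈ B, g₂ (t p) = 0 := by
    intro p hp
    have h := htop p hp
    rw [hvg] at h
    exact (mul_eq_zero.1 h).resolve_left two_ne_zero
  -- Step 3: the norm drops
  have hN₂ : ∑ e, (g₂ e).natAbs < N := by
    have h2N : 2 * ∑ e, (g₂ e).natAbs = N := by
      rw [← hN, Finset.mul_sum]
      refine Finset.sum_congr rfl fun e _ => ?_
      rw [hvg e, Int.natAbs_mul]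
      rfl
    have hNpos : 0 < N := by
      obtain ⟨e, he⟩ : ∃ e, v e ≠ 0 := by
        by_contra h
        push Not at h
        exact hv (funext h)
      rw [← hN]
      exact Finset.sum_pos' (fun _ _ => Nat.zero_le _) ⟨e, Finset.mem_univ _, Int.natAbs_pos.2 he⟩
    omega
  have hzero := ih _ hN₂ g₂ rfl hdiv₂ hwind₂ htop₂
  apply hv
  funext e
  rw [hvg e, hzero, Pi.zero_apply, mul_zero]

/-! ## §5 Elimination on the top links -/

omit [NeZero L] in
/-- **ELIMINATION.**  `L ≥ 2`; `(B, t, rank)` ranked.  For every integer chain `v` there are integers `c_p`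
with `(v − Σ_{p∈B} c_p σ∂p)(t p) = 0` for every `p ∈ B`: peel a maximal-rank plaquette `a` — its top link
lies on no other plaquette of `B`, and the pivot `σ∂a(t a) = ±1` divides everything. [ours] -/
theorem exists_coeff_sub_sum_apply_top_eq_zero (hL : 2 ≤ L) (B : Finset (Plaquette d L))
    (t : Plaquette d L → Edge d L)
    (ht : ∀ p ∈ B, t p ∈ ({(p.1, p.2.1.1), (p.1.shift p.2.1.1, p.2.1.2),
        (p.1.shift p.2.1.2, p.2.1.1), (p.1, p.2.1.2)} : Finset (Edge d L)))
    (rank : Plaquette d L → ℕ)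
    (hrank : ∀ p ∈ B, ∀ p' ∈ B, p ≠ p' → t p ∈ ({(p'.1, p'.2.1.1), (p'.1.shift p'.2.1.1, p'.2.1.2),
        (p'.1.shift p'.2.1.2, p'.2.1.1), (p'.1, p'.2.1.2)} : Finset (Edge d L)) → rank p < rank p')
    (v : Edge d L → ℤ) :
    ∃ c : Plaquette d L → ℤ, ∀ p ∈ B, (v - ∑ p' ∈ B, c p' • (Pi.single (p'.1, p'.2.1.1) 1 + Pi.single (p'.1.shift p'.2.1.1, p'.2.1.2) 1 -
        Pi.single (p'.1.shift p'.2.1.2, p'.2.1.1) 1 - Pi.single (p'.1, p'.2.1.2) 1 : Edge d L → ℤ)) (t p) = 0 := by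
  classical
  suffices key : ∀ s : Finset (Plaquette d L), s ⊆ B → ∀ v : Edge d L → ℤ, ∃ c : Plaquette d L → ℤ, ∀ p ∈ s,
      (v - ∑ p' ∈ s, c p' • (Pi.single (p'.1, p'.2.1.1) 1 + Pi.single (p'.1.shift p'.2.1.1, p'.2.1.2) 1 -
        Pi.single (p'.1.shift p'.2.1.2, p'.2.1.1) 1 - Pi.single (p'.1, p'.2.1.2) 1 : Edge d L → ℤ)) (t p) = 0 from
    key B subset_rfl v
  intro s
  induction s using Finset.induction_on_max_value rank with
  | empty =>
    intro _ v
    exact ⟨fun _ => 0, fun p hp => absurd hp (Finset.notMem_empty p)⟩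
  | insert a s has hmax ih =>
    intro hsub v
    have haB : a ∈ B := hsub (Finset.mem_insert_self a s)
    have hsB : s ⊆ B := fun p hp => hsub (Finset.mem_insert_of_mem hp)
    set ε : ℤ := (Pi.single (a.1, a.2.1.1) 1 + Pi.single (a.1.shift a.2.1.1, a.2.1.2) 1 -
        Pi.single (a.1.shift a.2.1.2, a.2.1.1) 1 - Pi.single (a.1, a.2.1.2) 1 : Edge d L → ℤ) (t a) with hε
    have hpiv : ε * ε = 1 := signedBoundary_apply_mul_self_of_mem hL a (ht a haB)
    obtain ⟨c, hc⟩ := ih hsB (v - (ε * v (t a)) • (Pi.single (a.1, a.2.1.1) 1 + Pi.single (a.1.shift a.2.1.1, a.2.1.2) 1 -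
        Pi.single (a.1.shift a.2.1.2, a.2.1.1) 1 - Pi.single (a.1, a.2.1.2) 1 : Edge d L → ℤ))
    refine ⟨Function.update c a (ε * v (t a)), ?_⟩
    have hsum : ∑ p' ∈ insert a s, Function.update c a (ε * v (t a)) p' • (Pi.single (p'.1, p'.2.1.1) 1 + Pi.single (p'.1.shift p'.2.1.1, p'.2.1.2) 1 -
        Pi.single (p'.1.shift p'.2.1.2, p'.2.1.1) 1 - Pi.single (p'.1, p'.2.1.2) 1 : Edge d L → ℤ) =
        (ε * v (t a)) • (Pi.single (a.1, a.2.1.1) 1 + Pi.single (a.1.shift a.2.1.1, a.2.1.2) 1 -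
        Pi.single (a.1.shift a.2.1.2, a.2.1.1) 1 - Pi.single (a.1, a.2.1.2) 1 : Edge d L → ℤ) +
          ∑ p' ∈ s, c p' • (Pi.single (p'.1, p'.2.1.1) 1 + Pi.single (p'.1.shift p'.2.1.1, p'.2.1.2) 1 -
        Pi.single (p'.1.shift p'.2.1.2, p'.2.1.1) 1 - Pi.single (p'.1, p'.2.1.2) 1 : Edge d L → ℤ) := by
      rw [Finset.sum_insert has, Function.update_self]
      congr 1
      refine Finset.sum_congr rfl fun p' hp' => ?_
      have hne : p' ≠ a := fun h => has (h ▸ hp')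
      rw [Function.update_of_ne hne]
    intro p hp
    rw [hsum, ← sub_sub]
    by_cases hpa : p = a
    · rw [hpa]
      have hvan : (∑ p' ∈ s, c p' • (Pi.single (p'.1, p'.2.1.1) 1 + Pi.single (p'.1.shift p'.2.1.1, p'.2.1.2) 1 -
        Pi.single (p'.1.shift p'.2.1.2, p'.2.1.1) 1 - Pi.single (p'.1, p'.2.1.2) 1 : Edge d L → ℤ)) (t a) = 0 := by
        rw [Finset.sum_apply]
        refine Finset.sum_eq_zero fun p' hp' => ?_
        have hne : a ≠ p' := fun h => has (h ▸ hp')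
        have hnot : t a ∉ ({(p'.1, p'.2.1.1), (p'.1.shift p'.2.1.1, p'.2.1.2),
        (p'.1.shift p'.2.1.2, p'.2.1.1), (p'.1, p'.2.1.2)} : Finset (Edge d L)) := by
          intro hmem
          have h1 := hrank a haB p' (hsB hp') hne hmem
          have h2 := hmax p' hp'
          omega
        rw [Pi.smul_apply, signedBoundary_apply_of_notMem p' hnot, smul_zero]
      rw [Pi.sub_apply, Pi.sub_apply, hvan, sub_zero, Pi.smul_apply, smul_eq_mul, ← hε]
      have : ε * v (t a) * ε = v (t a) := by
        rw [mul_comm ε, mul_assoc, hpiv, mul_one]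
      rw [this, sub_self]
    · exact hc p ((Finset.mem_insert.1 hp).resolve_left hpa)

/-! ## §6 The integer span -/

/-- **THE INTEGER SPAN OF A FULL RANKED STRUCTURE.**  `L ≥ 2`; `(B, t, rank)` ranked with
`#B = (d−1)(L^d − 1)`.  Every integer 1-chain `v` of `(ℤ/L)^d` with zero divergence and zero winding is
an integer combination `v = Σ_{p∈B} c_p σ∂p` of the signed boundaries of the covered plaquettes
(eliminate on the top links, §5; the remainder is `0` by descent, §4). [ours] -/
theorem exists_eq_sum_smul_signedBoundary (hL : 2 ≤ L) (B : Finset (Plaquette d L))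
    (t : Plaquette d L → Edge d L)
    (ht : ∀ p ∈ B, t p ∈ ({(p.1, p.2.1.1), (p.1.shift p.2.1.1, p.2.1.2),
        (p.1.shift p.2.1.2, p.2.1.1), (p.1, p.2.1.2)} : Finset (Edge d L)))
    (rank : Plaquette d L → ℕ)
    (hrank : ∀ p ∈ B, ∀ p' ∈ B, p ≠ p' → t p ∈ ({(p'.1, p'.2.1.1), (p'.1.shift p'.2.1.1, p'.2.1.2),
        (p'.1.shift p'.2.1.2, p'.2.1.1), (p'.1, p'.2.1.2)} : Finset (Edge d L)) → rank p < rank p')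
    (hcard : B.card = (d - 1) * (L ^ d - 1)) (v : Edge d L → ℤ)
    (hdiv : (fun y : Site d L => ∑ i : Fin d, (v (y, i) - v (y - Pi.single i 1, i))) = 0)
    (hwind : (fun m : Fin d => ∑ x ∈ (Finset.univ.filter fun x : Site d L => x m = 0), v (x, m)) = 0) :
    ∃ c : Plaquette d L → ℤ, v = ∑ p ∈ B, c p • (Pi.single (p.1, p.2.1.1) 1 + Pi.single (p.1.shift p.2.1.1, p.2.1.2) 1 -
        Pi.single (p.1.shift p.2.1.2, p.2.1.1) 1 - Pi.single (p.1, p.2.1.2) 1 : Edge d L → ℤ) := by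
  classical
  obtain ⟨c, hc⟩ := exists_coeff_sub_sum_apply_top_eq_zero hL B t ht rank hrank v
  refine ⟨c, ?_⟩
  set w : Edge d L → ℤ := v - ∑ p ∈ B, c p • (Pi.single (p.1, p.2.1.1) 1 + Pi.single (p.1.shift p.2.1.1, p.2.1.2) 1 -
        Pi.single (p.1.shift p.2.1.2, p.2.1.1) 1 - Pi.single (p.1, p.2.1.2) 1 : Edge d L → ℤ) with hw
  have hD := (intDivergence_isLinear (d := d) (L := L))
  have hW := (intWinding_isLinear (d := d) (L := L))
  -- the remainder has zero divergence and zero winding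
  have hdivw : (fun y : Site d L => ∑ i : Fin d, (w (y, i) - w (y - Pi.single i 1, i))) = 0 := by
    have h1 : (hD.mk') w = (hD.mk') v - ∑ p ∈ B, c p • (hD.mk') (Pi.single (p.1, p.2.1.1) 1 + Pi.single (p.1.shift p.2.1.1, p.2.1.2) 1 -
        Pi.single (p.1.shift p.2.1.2, p.2.1.1) 1 - Pi.single (p.1, p.2.1.2) 1 : Edge d L → ℤ) := by
      rw [hw, map_sub, map_sum]
      simp only [map_zsmul]
    have h2 : ∀ p : Plaquette d L, (hD.mk') (Pi.single (p.1, p.2.1.1) 1 + Pi.single (p.1.shift p.2.1.1, p.2.1.2) 1 -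
        Pi.single (p.1.shift p.2.1.2, p.2.1.1) 1 - Pi.single (p.1, p.2.1.2) 1 : Edge d L → ℤ) = 0 := fun p => by
      rw [IsLinearMap.mk'_apply]; exact intDivergence_signedBoundary p
    simp only [h2, smul_zero, Finset.sum_const_zero, sub_zero, IsLinearMap.mk'_apply] at h1
    rw [h1]; exact hdiv
  have hwindw : (fun m : Fin d => ∑ x ∈ (Finset.univ.filter fun x : Site d L => x m = 0), w (x, m)) = 0 := by
    have h1 : (hW.mk') w = (hW.mk') v - ∑ p ∈ B, c p • (hW.mk') (Pi.single (p.1, p.2.1.1) 1 + Pi.single (p.1.shift p.2.1.1, p.2.1.2) 1 -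
        Pi.single (p.1.shift p.2.1.2, p.2.1.1) 1 - Pi.single (p.1, p.2.1.2) 1 : Edge d L → ℤ) := by
      rw [hw, map_sub, map_sum]
      simp only [map_zsmul]
    have h2 : ∀ p : Plaquette d L, (hW.mk') (Pi.single (p.1, p.2.1.1) 1 + Pi.single (p.1.shift p.2.1.1, p.2.1.2) 1 -
        Pi.single (p.1.shift p.2.1.2, p.2.1.1) 1 - Pi.single (p.1, p.2.1.2) 1 : Edge d L → ℤ) = 0 := fun p => by
      rw [IsLinearMap.mk'_apply]; funext m; exact intWinding_signedBoundary p m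
    simp only [h2, smul_zero, Finset.sum_const_zero, sub_zero, IsLinearMap.mk'_apply] at h1
    rw [h1]; exact hwind
  have hzero := eq_zero_of_divergence_winding_top hL B t ht rank hrank hcard w hdivw hwindw hc
  rw [hw] at hzero
  exact (sub_eq_zero.1 hzero)

omit [NeZero L] in
/-- **The coefficients are unique**: the signed boundaries of a ranked structure are `ℤ`-independent
(the top-link pivots, §1). [ours] -/
theorem sum_smul_signedBoundary_unique (hL : 2 ≤ L) (B : Finset (Plaquette d L))
    (t : Plaquette d L → Edge d L)
    (ht : ∀ p ∈ B, t p ∈ ({(p.1, p.2.1.1), (p.1.shift p.2.1.1, p.2.1.2),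
        (p.1.shift p.2.1.2, p.2.1.1), (p.1, p.2.1.2)} : Finset (Edge d L)))
    (rank : Plaquette d L → ℕ)
    (hrank : ∀ p ∈ B, ∀ p' ∈ B, p ≠ p' → t p ∈ ({(p'.1, p'.2.1.1), (p'.1.shift p'.2.1.1, p'.2.1.2),
        (p'.1.shift p'.2.1.2, p'.2.1.1), (p'.1, p'.2.1.2)} : Finset (Edge d L)) → rank p < rank p')
    (c c' : Plaquette d L → ℤ)
    (h : ∑ p ∈ B, c p • (Pi.single (p.1, p.2.1.1) 1 + Pi.single (p.1.shift p.2.1.1, p.2.1.2) 1 -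
        Pi.single (p.1.shift p.2.1.2, p.2.1.1) 1 - Pi.single (p.1, p.2.1.2) 1 : Edge d L → ℤ) =
      ∑ p ∈ B, c' p • (Pi.single (p.1, p.2.1.1) 1 + Pi.single (p.1.shift p.2.1.1, p.2.1.2) 1 -
        Pi.single (p.1.shift p.2.1.2, p.2.1.1) 1 - Pi.single (p.1, p.2.1.2) 1 : Edge d L → ℤ)) :
    ∀ p ∈ B, c p = c' p := by
  have hz := eq_zero_of_sum_smul_signedBoundary_apply_top hL B t ht rank hrank (fun p => c p - c' p)
    (fun p hp => by
      have hsub : ∑ p' ∈ B, (c p' - c' p') • (Pi.single (p'.1, p'.2.1.1) 1 + Pi.single (p'.1.shift p'.2.1.1, p'.2.1.2) 1 -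
        Pi.single (p'.1.shift p'.2.1.2, p'.2.1.1) 1 - Pi.single (p'.1, p'.2.1.2) 1 : Edge d L → ℤ) =
          ∑ p' ∈ B, c p' • (Pi.single (p'.1, p'.2.1.1) 1 + Pi.single (p'.1.shift p'.2.1.1, p'.2.1.2) 1 -
        Pi.single (p'.1.shift p'.2.1.2, p'.2.1.1) 1 - Pi.single (p'.1, p'.2.1.2) 1 : Edge d L → ℤ) -
            ∑ p' ∈ B, c' p' • (Pi.single (p'.1, p'.2.1.1) 1 + Pi.single (p'.1.shift p'.2.1.1, p'.2.1.2) 1 -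
        Pi.single (p'.1.shift p'.2.1.2, p'.2.1.1) 1 - Pi.single (p'.1, p'.2.1.2) 1 : Edge d L → ℤ) := by
        rw [← Finset.sum_sub_distrib]
        exact Finset.sum_congr rfl fun p' _ => sub_smul _ _ _
      rw [hsub, h, sub_self, Pi.zero_apply])
  intro p hp
  exact sub_eq_zero.1 (hz p hp)

/-- **Every plaquette boundary — covered or not — is an integer combination of the covered ones** for a
full ranked structure (`L ≥ 2`, `#B = (d−1)(L^d − 1)`). [ours] -/
theorem exists_signedBoundary_eq_sum (hL : 2 ≤ L) (B : Finset (Plaquette d L))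
    (t : Plaquette d L → Edge d L)
    (ht : ∀ p ∈ B, t p ∈ ({(p.1, p.2.1.1), (p.1.shift p.2.1.1, p.2.1.2),
        (p.1.shift p.2.1.2, p.2.1.1), (p.1, p.2.1.2)} : Finset (Edge d L)))
    (rank : Plaquette d L → ℕ)
    (hrank : ∀ p ∈ B, ∀ p' ∈ B, p ≠ p' → t p ∈ ({(p'.1, p'.2.1.1), (p'.1.shift p'.2.1.1, p'.2.1.2),
        (p'.1.shift p'.2.1.2, p'.2.1.1), (p'.1, p'.2.1.2)} : Finset (Edge d L)) → rank p < rank p')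
    (hcard : B.card = (d - 1) * (L ^ d - 1)) (p' : Plaquette d L) :
    ∃ c : Plaquette d L → ℤ, (Pi.single (p'.1, p'.2.1.1) 1 + Pi.single (p'.1.shift p'.2.1.1, p'.2.1.2) 1 -
        Pi.single (p'.1.shift p'.2.1.2, p'.2.1.1) 1 - Pi.single (p'.1, p'.2.1.2) 1 : Edge d L → ℤ) =
      ∑ p ∈ B, c p • (Pi.single (p.1, p.2.1.1) 1 + Pi.single (p.1.shift p.2.1.1, p.2.1.2) 1 -
        Pi.single (p.1.shift p.2.1.2, p.2.1.1) 1 - Pi.single (p.1, p.2.1.2) 1 : Edge d L → ℤ) :=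
  exists_eq_sum_smul_signedBoundary hL B t ht rank hrank hcard _ (intDivergence_signedBoundary p')
    (funext fun m => intWinding_signedBoundary p' m)

end Summit.Ventures.LatticeQCDFlow.Theory2.Autoregressive
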